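import Literature.AlgebraicGeometry.Modules.ModuleCechFiniteOfProper
import Literature.AlgebraicGeometry.Modules.AffineTestObjects
import Literature.AlgebraicGeometry.Morphisms.CohOfVectorBundle
import Literature.Algebra.Homology.PerfectOfPseudoCoherent
import Literature.Algebra.Homology.FiniteFreeResolution
import HarnessLib

/-!
# The Grothendieck complex of a vector bundle on a proper flat scheme over an affine noetherian base, and the
# affine base change of the module Čech complex (Görtz–Wedhorn II, Cor. 23.135, Prop. 22.90; Mumford,
# *Abelian Varieties*, §5, Lemmas 1–2 and Cor. 2; EGA III 6.10.5)

Topic `AlgebraicGeometry/Modules`; namespace `Literature.AlgebraicGeometry.Modules`; a *proofs* file (theorems only; no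
definition, no named fact, no instance, no notation).  Sequel to `Modules/ModuleCechFiniteOfProper` (finiteness of the
module Čech cohomology `Hⁱ(Č•(𝓤, G))` of a coherent `G` on a proper `g : X → B`, `B` affine locally noetherian, base
ring `g♯ : Γ(B, 𝒪_B) → Γ(X, 𝒪_X)`).  For an ARBITRARY proper (flat) `X → B` — e.g. an abelian scheme over an affine
base, which is not a product `P ×_K T` (the case of ★ `Modules/ModuleCechPerfect`, `Modules/AffineTestObjects`,
`Modules/GrothendieckComplexKernelRepr`) — this file proves:

* §1 `Modules.flat_secMod_of_flat` — for `g` FLAT, `U_s` affine and `G` finite locally free, `Γ(G, U_s)` is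
  `Γ(B, 𝒪_B)`-flat (Mumford §5: "the Čech complex … is a complex of `A`-flat modules"), and
  **`Modules.exists_strictlyPerfect_quasiIso_cechComplex_of_isProper`** — THE GROTHENDIECK COMPLEX: for `g : X → B`
  proper and flat, `B` affine locally noetherian, `G` finite locally free and a finite cover `𝓤` with affine finite
  intersections (`#ι ≤ r + 1`), a complex `K•` of finitely generated projective `Γ(B, 𝒪_B)`-modules in degrees
  `[0, r]` with a quasi-isomorphism `K• → Č•(𝓤, G)` (Görtz–Wedhorn II, Cor. 23.135; Mumford §5, Lemma 1; EGA III
  6.10.5) — finite cohomology over a noetherian ring ⇒ finite free resolution (`Algebra/Homology/FiniteFreeResolution`),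
  flat terms in `[0, r]` ⇒ strictly perfect there (`Algebra/Homology/PerfectOfPseudoCoherent`);
* §2 **`Modules.exists_extendScalars_cechComplex_iso_of_isPullback`** — AFFINE BASE CHANGE of the module Čech complex
  (Görtz–Wedhorn II, proof of Prop. 22.90, "`Č•((U_i)_i, 𝓕) ⊗_A A′ ≅ Č•((u′⁻¹(U_i))_i, 𝓕′)`"): for a cartesian square
  `k ≫ g = g' ≫ j` over an affine `j : B' → B`, a finite family `𝓤` with affine non-empty intersections and `G`
  affine-localizing, an isomorphism of cochain complexes of `Γ(B', 𝒪_{B'})`-modules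
  `Φ : (extendScalars j♯)(Č•(𝓤, G)) ≅ Č•(k⁻¹𝓤, k^*G)` with `Φₙ(b ⊗ c)_s = b · η(c_s)|` (`Modules/PullbackSectionsBaseChange`
  termwise, `Algebra/Homology/OrderedCechSystemBaseChange` for the assembly; `j♯` in `appLE ⊤ ⊤` form, as in
  ★ `Modules/AffineTestObjects`);
* §3 **`Modules.exists_secMod_top_linearEquiv_ker_baseChange`** — `H⁰` AND BASE CHANGE, NATURALLY IN THE TEST OBJECT
  (Görtz–Wedhorn II, Cor. 23.135 / (23.28.5); Mumford §5, Lemma 2 and Cor. 2): a `Γ(B', 𝒪_{B'})`-linear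
  `e' : Γ(X', k^*G) ≃ ker(d⁰_{Č•(𝓤, G)} ⊗ Γ(B'))` whose square with the pull-back of global sections `t ↦ η(t)` and
  `z ↦ 1 ⊗ z` on `Γ(X, G) ≅ ker d⁰` (★ `kerDZeroEquiv`) commutes; across the strictly perfect `K• → Č•` of §1 and
  ★ `Algebra/Homology/VanishingBaseChangeOfQuasiIso` this is "`Γ(X_{B'}, G_{B'}) = ker(d⁰_K ⊗ B')` naturally in `B'`".

Everything is proved; no named facts.  Universe `Scheme.{0}` (that of `Modules/ModuleCechFiniteOfProper`).  Mathlib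
searched (pin): `HasRingHomProperty.appLE` (`Flat`), `ModuleCat.extendScalars`, `ModuleCat.ExtendScalars.map_tmul`,
`HomologicalComplex.Hom.comm`, `HomologicalComplex.eval`, `Iso.toLinearEquiv`, `LinearMap.baseChange_tmul`,
`Scheme.Hom.preimage_iSup` (used); Mathlib has no Grothendieck complex and no base change for Čech complexes of
quasi-coherent modules.  Cell `hodgecm-mathlib`, F-DAG first hand (h2) «cohomology and base change» (B-p04 (g18)
author; his LACKS-(ii), inputs `P`/`hP`/`hC` of ★ `exact_baseChange_of_quasiIso_of_exact_residueField` and the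
`H⁰`-square of FILE 4), B-p19 (g14); generic, count-neutral, books 0.

## References

* U. Görtz, T. Wedhorn, *Algebraic Geometry II: Cohomology of Schemes*, Springer Spektrum (2023),
  doi:10.1007/978-3-658-43031-3: proof of Prop. 22.90 (p. 277); Thm. 23.133 with proof, Steps (I)–(III), Rem. 23.134,
  Cor. 23.135 (pp. 354–355), (23.28.5). [GortzWedhorn2023]
* U. Görtz, T. Wedhorn, *Algebraic Geometry I: Schemes*, 2nd ed. (2020), Prop. 7.24 (2), Rem. 7.25, Cor. 7.42. [GortzWedhorn2020]
* D. Mumford, *Abelian Varieties*, TIFR Studies in Mathematics 5 (1970), §5, Lemmas 1–2, Cor. 2 (pp. 46–50). [MumfordAV1970]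
* A. Grothendieck, EGA III₂ (Publ. Math. IHÉS 17, 1963), (6.10.5), (7.7.6). [EGAIII2]
-/

noncomputable section

set_option backward.isDefEq.respectTransparency false

open CategoryTheory CategoryTheory.Limits Opposite TopologicalSpace AlgebraicGeometry TensorProduct
open Literature.Algebra.Homology

namespace Literature.AlgebraicGeometry.Modules

open Literature.AlgebraicGeometry.Morphisms Literature.AlgebraicGeometry.HodgeTheory Literature.AlgebraicGeometry.Motives

/-! ## §1 Flat terms and the strictly perfect model (the Grothendieck complex) -/

section Grothendieck

variable {X B : Scheme.{0}} (g : X ⟶ B) [IsAffine B] [IsProper g] [IsLocallyNoetherian B]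
  {ι : Type} [LinearOrder ι] [Fintype ι] (U : ι → X.Opens) (hcov : ⨆ i, U i = ⊤)
  (hUa : ∀ s : Finset ι, s.Nonempty → IsAffineOpen (cechOpen U s)) (G : X.Modules)

omit [IsAffine B] [IsProper g] [IsLocallyNoetherian B] [LinearOrder ι] [Fintype ι] in
/-- The structure map `Γ(B, 𝒪_B) → Γ(V, 𝒪_X)` through `g♯` is the `appLE` of `g` (definitional).
[cite: GortzWedhorn2023, Thm. 23.133, proof, Step (I) (p. 354)] -/
theorem toSections_appTop (V : X.Opens) : toSections g.appTop.hom V = (g.appLE ⊤ V le_top).hom := rfl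

include hUa in
omit [IsProper g] [IsLocallyNoetherian B] [LinearOrder ι] [Fintype ι] in
/-- **The members `Γ(G, U_s)` (`s ≠ ∅`) are flat over `Γ(B, 𝒪_B)`** for `g : X → B` FLAT, `B` and `U_s` affine and
`G` finite locally free (Mumford §5: "the Čech complex … is a complex of `A`-flat modules").
[cite: MumfordAV1970, §5, Lemma 1] [cite: GortzWedhorn2020, Cor. 7.42] -/
theorem flat_secMod_of_flat [Flat g] (hL : IsFiniteLocallyFree G) (s : Finset ι) (hs : s.Nonempty) :
    Module.Flat Γ(B, ⊤) (SecMod G g.appTop.hom (cechOpen U s)) :=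
  flat_secMod_of_isFiniteLocallyFree G g.appTop.hom (hUa s hs) hL
    (HasRingHomProperty.appLE (P := @Flat) g inferInstance ⟨⊤, isAffineOpen_top B⟩ ⟨cechOpen U s, hUa s hs⟩ le_top)

include hcov hUa in
/-- **The Grothendieck complex of a vector bundle on a proper flat scheme over an affine noetherian base**
(Görtz–Wedhorn II, Cor. 23.135; Mumford, *Abelian Varieties*, §5, Lemma 1; EGA III 6.10.5): for `g : X → B`
PROPER and FLAT, `B` affine locally noetherian, `G` finite locally free and a finite cover `𝓤` of `X` with affine
finite intersections (`#ι ≤ r + 1`), there is a complex `K•` of finitely generated projective `Γ(B, 𝒪_B)`-modules in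
degrees `[0, r]` with a quasi-isomorphism `K• → Č•(𝓤, G)` (finite cohomology over a noetherian ring ⇒ finite free
resolution, Görtz–Wedhorn II Cor. 22.62 = `Algebra/Homology/FiniteFreeResolution`; flat terms in `[0, r]` ⇒ strictly
perfect there, Lemma 21.173 = `Algebra/Homology/PerfectOfPseudoCoherent`). This is ★
`Modules/ModuleCechPerfect.exists_strictlyPerfect_quasiIso_cechComplex` with `P ×_K T → T` replaced by an arbitrary
proper flat `X → B` (e.g. an abelian scheme over an affine base).
[cite: GortzWedhorn2023, Cor. 23.135 (p. 355); Thm. 23.133, proof, Steps (I)–(III) (pp. 354–355)] [cite: MumfordAV1970, §5, Lemma 1] [cite: EGAIII2, (6.10.5)] -/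
theorem exists_strictlyPerfect_quasiIso_cechComplex_of_isProper [Flat g] (hL : IsFiniteLocallyFree G)
    (r : ℕ) (hr : (Fintype.card ι : ℤ) ≤ r + 1) :
    ∃ (K : CochainComplex (ModuleCat.{0} Γ(B, ⊤)) ℤ) (ψ : K ⟶ cechComplex U G g.appTop.hom),
      QuasiIso ψ ∧ K.IsStrictlyGE 0 ∧ K.IsStrictlyLE (r : ℤ) ∧
      ∀ n, Module.Finite Γ(B, ⊤) (K.X n) ∧ Module.Projective Γ(B, ⊤) (K.X n) := by
  haveI : IsNoetherianRing Γ(B, ⊤) := IsLocallyNoetherian.component_noetherian ⟨⊤, isAffineOpen_top B⟩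
  have hG : Coh G := coh_of_isVectorBundle hL.isVectorBundle
  have hflat := flat_secMod_of_flat g U hUa G hL
  haveI : (cechComplex U G g.appTop.hom).IsStrictlyLE (r : ℤ) := isStrictlyLE_cechComplex U G _ r hr
  haveI : (cechComplex U G g.appTop.hom).IsStrictlyGE 0 := isStrictlyGE_cechComplex U G _
  obtain ⟨F, φ, hφ, hFle, hF⟩ := exists_finiteFree_quasiIso_of_finite_homology (cechComplex U G g.appTop.hom)
    (r : ℤ) (module_finite_homology_cechComplex_of_isProper g U hcov hUa G hG)
  haveI := hφ
  haveI := hFle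
  exact exists_strictlyPerfect_quasiIso_of_flat (cechComplex U G g.appTop.hom) r
    (flat_cechComplex_X U G _ hflat) F (r : ℤ) (fun n => ⟨(hF n).1, by haveI := (hF n).2; exact Module.Projective.of_free⟩) φ

end Grothendieck

/-! ## §2 Affine base change of the module Čech complex along a cartesian square -/

section BaseChange

variable {X B X' B' : Scheme.{0}} {g : X ⟶ B} {g' : X' ⟶ B'} {k : X' ⟶ X} {j : B' ⟶ B}
  [IsAffine B] [IsAffine B'] (H : IsPullback k g' g j)
  {ι : Type} [LinearOrder ι] [Fintype ι] (U : ι → X.Opens)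
  (hUa : ∀ s : Finset ι, s.Nonempty → IsAffineOpen (cechOpen U s)) (G : X.Modules)

omit [IsAffine B] [IsAffine B'] [LinearOrder ι] [Fintype ι] in
/-- `(k⁻¹𝓤)_s = k⁻¹(U_s) ∩ g'⁻¹⊤`. [cite: GortzWedhorn2023, Prop. 22.90 (p. 277), proof] -/
theorem cechOpen_preimage_eq_inf (s : Finset ι) :
    cechOpen (fun i => k ⁻¹ᵁ U i) s = k ⁻¹ᵁ cechOpen U s ⊓ g' ⁻¹ᵁ ⊤ := by
  rw [← preimage_cechOpen, Scheme.Hom.preimage_top, inf_top_eq]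

include H hUa in
/-- **Affine base change of the module Čech complex** (Görtz–Wedhorn II, proof of Prop. 22.90: "`Č•((U_i)_i, 𝓕) ⊗_A
A′ ≅ Č•((u′⁻¹(U_i))_i, 𝓕′)`"; Mumford §5, Lemma 2 setting): for a CARTESIAN square `k ≫ g = g' ≫ j` of schemes
with `B`, `B'` AFFINE, a finite family `𝓤` of opens of `X` with affine non-empty intersections and an
affine-localizing (e.g. quasi-coherent) `𝒪_X`-module `G`, extension of scalars along
`j♯ : Γ(B, 𝒪_B) → Γ(B', 𝒪_{B'})` (in `appLE ⊤ ⊤` form) of `Č•(𝓤, G)` (base ring `g♯`) is isomorphic, as a cochain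
complex of `Γ(B', 𝒪_{B'})`-modules, to `Č•(k⁻¹𝓤, k^*G)` (base ring `g'♯`), by an isomorphism `Φ` with
**`Φₙ (b ⊗ c) = b · (η(c_s)|_{k⁻¹U_s})_s`** — termwise the affine base change of sections
`Γ(B') ⊗_{Γ(B)} Γ(U_s, G) ≅ Γ(k⁻¹U_s, k^*G)` (`Modules/PullbackSectionsBaseChange`), assembled by
`Algebra/Homology/OrderedCechSystemBaseChange`. (★ `Modules/AffineTestObjects` is the case `k = P ◁ j` of a product
family.) [cite: GortzWedhorn2023, Prop. 22.90 (p. 277), proof] [cite: GortzWedhorn2020, Prop. 7.24 (2) and Rem. 7.25] [cite: MumfordAV1970, §5, Lemma 2] -/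
theorem exists_extendScalars_cechComplex_iso_of_isPullback (hG : IsAffineLocalizing G) :
    letI := (j.appLE ⊤ ⊤ le_top).hom.toAlgebra
    ∃ Φ : ((ModuleCat.extendScalars (j.appLE ⊤ ⊤ le_top).hom).mapHomologicalComplex (ComplexShape.up ℤ)).obj
        (cechComplex U G g.appTop.hom) ≅
      cechComplex (fun i => k ⁻¹ᵁ U i) ((Scheme.Modules.pullback k).obj G) g'.appTop.hom,
      ∀ (n : ℤ) (b : Γ(B', ⊤)) (c : OrderedCech.SysCochain (sectionsSystem U G g.appTop.hom) n)
        (σ : OrderedCech.Simplex ι n),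
        ((Φ.hom.f n).hom (b ⊗ₜ[Γ(B, ⊤)] c) :
            OrderedCech.SysCochain (sectionsSystem (fun i => k ⁻¹ᵁ U i) ((Scheme.Modules.pullback k).obj G)
              g'.appTop.hom) n) σ =
          b • SecMod.mk (ρ := g'.appTop.hom) (unitSectionLE k G (V := cechOpen U σ.1)
            (preimage_cechOpen U k σ.1).symm.le (SecMod.val (L := G) (ρ := g.appTop.hom) (c σ))) := by
  -- notation
  let f : Γ(B, ⊤) →+* Γ(B', ⊤) := (j.appLE ⊤ ⊤ le_top).hom
  letI : Algebra Γ(B, ⊤) Γ(B', ⊤) := f.toAlgebra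
  let ρ : Γ(B, ⊤) →+* Γ(X, ⊤) := g.appTop.hom
  let ρ' : Γ(B', ⊤) →+* Γ(X', ⊤) := g'.appTop.hom
  let U' : ι → X'.Opens := fun i => k ⁻¹ᵁ U i
  let G' : X'.Modules := (Scheme.Modules.pullback k).obj G
  let M := sectionsSystem U G ρ
  let M' := sectionsSystem U' G' ρ'
  have hU' : ∀ s : Finset ι, cechOpen U' s = k ⁻¹ᵁ cechOpen U s ⊓ g' ⁻¹ᵁ ⊤ := cechOpen_preimage_eq_inf U
  -- termwise: the affine base change of sections on the non-empty members
  have hex : ∀ (s : Finset ι) (hs : s.Nonempty),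
      ∃ e : Γ(B', ⊤) ⊗[Γ(B, ⊤)] SecMod G ρ (cechOpen U s) ≃ₗ[Γ(B', ⊤)] SecMod G' ρ' (cechOpen U' s),
        ∀ (b : Γ(B', ⊤)) (m : SecMod G ρ (cechOpen U s)),
          e (b ⊗ₜ m) = b • SecMod.mk (ρ := ρ') (unitSectionLE k G (le_preimage_left_of_eq_inf (hU' s))
            (SecMod.val (L := G) (ρ := ρ) m)) := by
    intro s hs
    letI : Module Γ(B, ⊤) Γ(G, cechOpen U s) := SecMod.instModule G ρ (cechOpen U s)
    letI : Module Γ(B', ⊤) Γ(G', cechOpen U' s) := SecMod.instModule G' ρ' (cechOpen U' s)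
    exact exists_linearEquiv_tensor_sections_pullback H (isAffineOpen_top B) (isAffineOpen_top B') (hUa s hs)
      le_top (fun x _ => trivial) (hU' s) G hG rfl (fun r m => rfl) (fun t n => rfl)
  choose e he using hex
  -- the `j♯`-semilinear pull-back of sections `Θ_s m = e_s (1 ⊗ m)` (zero on `s = ∅`, which never enters)
  let Θ₀ : ∀ (s : Finset ι) (hs : s.Nonempty), SecMod G ρ (cechOpen U s) →ₛₗ[f] SecMod G' ρ' (cechOpen U' s) :=
    fun s hs =>
    { toFun := fun m => e s hs (1 ⊗ₜ m)
      map_add' := fun m m' => by rw [TensorProduct.tmul_add, map_add]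
      map_smul' := fun a m => by
        rw [← TensorProduct.smul_tmul, ← LinearEquiv.map_smul]
        congr 1 }
  let Θ : ∀ s : Finset ι, M.obj s →ₛₗ[f] M'.obj s := fun s => if hs : s.Nonempty then Θ₀ s hs else 0
  have hΘ_apply : ∀ (s : Finset ι) (hs : s.Nonempty) (m : SecMod G ρ (cechOpen U s)),
      Θ s m = e s hs (1 ⊗ₜ m) := fun s hs m => by
    change (if hs : s.Nonempty then Θ₀ s hs else 0) m = _
    rw [dif_pos hs]
    rfl
  -- the base-change maps `b ⊗ m ↦ b • Θ m` ARE the chosen isomorphisms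
  have hbc : ∀ (s : Finset ι) (hs : s.Nonempty) (z : Γ(B', ⊤) ⊗[Γ(B, ⊤)] SecMod G ρ (cechOpen U s)),
      OrderedCech.sysBaseChangeMap f (M := M) (M' := M') Θ s z = e s hs z := by
    intro s hs z
    induction z using TensorProduct.induction_on with
    | zero => rw [map_zero, map_zero]
    | tmul b m =>
      rw [OrderedCech.sysBaseChangeMap_tmul, hΘ_apply s hs]
      change b • e s hs (1 ⊗ₜ m) = _
      rw [← LinearEquiv.map_smul, TensorProduct.smul_tmul', smul_eq_mul, mul_one]
    | add x y hx hy => rw [map_add, map_add, hx, hy]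
  have hbij : ∀ s : Finset ι, s.Nonempty →
      Function.Bijective (OrderedCech.sysBaseChangeMap f (M := M) (M' := M') Θ s) := fun s hs => by
    have heq : (OrderedCech.sysBaseChangeMap f (M := M) (M' := M') Θ s : _ → _) = e s hs := funext (hbc s hs)
    rw [heq]
    exact (e s hs).bijective
  -- naturality of `Θ` in the member (naturality of the affine base change in the open)
  have hΘ : ∀ {s t : Finset ι} (_ : s.Nonempty) (h : s ⟶ t) (x : M.obj s),
      Θ t ((M.map h).hom x) = (M'.map h).hom (Θ s x) := by
    intro s t hs h x
    have ht : t.Nonempty := hs.mono h.le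
    rw [hΘ_apply t ht, hΘ_apply s hs]
    letI : Module Γ(B, ⊤) Γ(G, cechOpen U s) := SecMod.instModule G ρ (cechOpen U s)
    letI : Module Γ(B, ⊤) Γ(G, cechOpen U t) := SecMod.instModule G ρ (cechOpen U t)
    letI : Module Γ(B', ⊤) Γ(G', cechOpen U' s) := SecMod.instModule G' ρ' (cechOpen U' s)
    letI : Module Γ(B', ⊤) Γ(G', cechOpen U' t) := SecMod.instModule G' ρ' (cechOpen U' t)
    have key := map_tensor_sections_pullback_natural (iY := g') (hU' s) (hU' t) (cechOpen_anti U h.le)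
      G (fun _ _ => rfl) (fun _ _ => rfl)
      (SecMod.res G ρ (cechOpen_anti U h.le)) (fun _ => rfl)
      (e s hs).toLinearMap (he s hs) (e t ht).toLinearMap (he t ht) ((1 : Γ(B', ⊤)) ⊗ₜ x)
    rw [TensorProduct.map_tmul, LinearMap.id_apply] at key
    exact key.symm
  refine ⟨OrderedCech.extendScalarsSysComplexIso f Θ (fun {s} {t} hs h x => hΘ hs h x) hbij, fun n b c σ => ?_⟩
  -- the element formula
  change (OrderedCech.extendScalarsSysXIso f Θ hbij n).hom (b ⊗ₜ c) σ = _
  rw [OrderedCech.extendScalarsSysXIso_hom_tmul]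
  change b • (OrderedCech.SysCochain.mapₛₗ f Θ n c σ) = _
  rw [OrderedCech.SysCochain.mapₛₗ_apply, hΘ_apply σ.1 σ.2.1, he, one_smul]

include H hUa in
/-- `Nonempty` form of `exists_extendScalars_cechComplex_iso_of_isPullback` (the isomorphism of complexes alone).
[cite: GortzWedhorn2023, Prop. 22.90 (p. 277), proof] -/
theorem nonempty_extendScalars_cechComplex_iso_of_isPullback (hG : IsAffineLocalizing G) :
    Nonempty (((ModuleCat.extendScalars (j.appLE ⊤ ⊤ le_top).hom).mapHomologicalComplex (ComplexShape.up ℤ)).obj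
        (cechComplex U G g.appTop.hom) ≅
      cechComplex (fun i => k ⁻¹ᵁ U i) ((Scheme.Modules.pullback k).obj G) g'.appTop.hom) :=
  let ⟨Φ, _⟩ := exists_extendScalars_cechComplex_iso_of_isPullback H U hUa G hG
  ⟨Φ⟩

/-! ## §3 The natural representation of `Γ(X', k^*G)` as `ker(d⁰ ⊗ Γ(B'))` -/

include H hUa in
/-- **`H⁰` and base change, naturally in the test object** (Görtz–Wedhorn II, Cor. 23.135 / (23.28.5); Mumford §5,
Lemma 2 and Cor. 2): for the cartesian square over the affine `j : B' → B` and a cover `𝓤` of `X` with affine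
non-empty intersections there is a `Γ(B', 𝒪_{B'})`-linear isomorphism
`e' : Γ(X', k^*G) ≃ ker(d⁰_{Č•(𝓤, G)} ⊗ Γ(B'))` such that the square with the pull-back of global sections
`Γ(X, G) → Γ(X', k^*G)`, `t ↦ η(t)`, and `z ↦ 1 ⊗ z` on `Γ(X, G) ≅ ker d⁰` (★ `kerDZeroEquiv`) commutes:
`e'(η t) = 1 ⊗ (t|_{U_s})_s`.  (Across a strictly perfect model `K• → Č•` — §1 — this is the Grothendieck-complex
statement "`Γ(X_{B'}, G_{B'}) = ker(d⁰_K ⊗ B')` naturally in `B'`", ★ `Modules/GrothendieckComplexKernelRepr(Natural)`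
for product families.) [cite: GortzWedhorn2023, Cor. 23.135 (p. 355); Prop. 22.90 (p. 277), proof] [cite: MumfordAV1970, §5, Lemma 2 and Cor. 2] -/
theorem exists_secMod_top_linearEquiv_ker_baseChange (hcov : ⨆ i, U i = ⊤) (hG : IsAffineLocalizing G) :
    letI := (j.appLE ⊤ ⊤ le_top).hom.toAlgebra
    ∃ e' : SecMod ((Scheme.Modules.pullback k).obj G) g'.appTop.hom ⊤ ≃ₗ[Γ(B', ⊤)]
        LinearMap.ker ((OrderedCech.sysD (sectionsSystem U G g.appTop.hom) 0).baseChange Γ(B', ⊤)),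
      ∀ t : SecMod G g.appTop.hom ⊤,
        ((e' (SecMod.mk (ρ := g'.appTop.hom) (unitSectionLE k G (V := ⊤) (U := ⊤) le_top
            (SecMod.val (L := G) (ρ := g.appTop.hom) t))) : _) : Γ(B', ⊤) ⊗[Γ(B, ⊤)]
              OrderedCech.SysCochain (sectionsSystem U G g.appTop.hom) 0) =
          (1 : Γ(B', ⊤)) ⊗ₜ[Γ(B, ⊤)] ((kerDZeroEquiv U G g.appTop.hom hcov t : _) :
            OrderedCech.SysCochain (sectionsSystem U G g.appTop.hom) 0) := by
  let f : Γ(B, ⊤) →+* Γ(B', ⊤) := (j.appLE ⊤ ⊤ le_top).hom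
  letI : Algebra Γ(B, ⊤) Γ(B', ⊤) := f.toAlgebra
  let ρ : Γ(B, ⊤) →+* Γ(X, ⊤) := g.appTop.hom
  let ρ' : Γ(B', ⊤) →+* Γ(X', ⊤) := g'.appTop.hom
  let U' : ι → X'.Opens := fun i => k ⁻¹ᵁ U i
  let G' : X'.Modules := (Scheme.Modules.pullback k).obj G
  let M := sectionsSystem U G ρ
  let M' := sectionsSystem U' G' ρ'
  let C : CochainComplex (ModuleCat.{0} Γ(B, ⊤)) ℤ := cechComplex U G ρ
  let C' : CochainComplex (ModuleCat.{0} Γ(B', ⊤)) ℤ := cechComplex U' G' ρ'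
  have hcov' : ⨆ i, U' i = ⊤ := by
    change ⨆ i, k ⁻¹ᵁ U i = ⊤
    rw [← Scheme.Hom.preimage_iSup, hcov, Scheme.Hom.preimage_top]
  obtain ⟨Φ, hΦ⟩ := exists_extendScalars_cechComplex_iso_of_isPullback H U hUa G hG
  -- degrees `0` and `1` of `Φ` as linear equivalences, and the square with the differentials
  let Φ₀ : Γ(B', ⊤) ⊗[Γ(B, ⊤)] OrderedCech.SysCochain M 0 ≃ₗ[Γ(B', ⊤)] OrderedCech.SysCochain M' 0 :=
    ((HomologicalComplex.eval _ _ 0).mapIso Φ).toLinearEquiv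
  let Φ₁ : Γ(B', ⊤) ⊗[Γ(B, ⊤)] OrderedCech.SysCochain M 1 ≃ₗ[Γ(B', ⊤)] OrderedCech.SysCochain M' 1 :=
    ((HomologicalComplex.eval _ _ 1).mapIso Φ).toLinearEquiv
  have hΦ₀ : ∀ y, Φ₀ y = (Φ.hom.f 0).hom y := fun _ => rfl
  have hΦ₁ : ∀ y, Φ₁ y = (Φ.hom.f 1).hom y := fun _ => rfl
  have hd : ∀ c, (C.d 0 1).hom c = OrderedCech.sysD M 0 c := fun c => by
    change ((cechComplex U G ρ).d 0 (0 + 1)).hom c = _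
    rw [OrderedCech.sysComplex_d]
    rfl
  have hd' : ∀ z, (C'.d 0 1).hom z = OrderedCech.sysD M' 0 z := fun z => by
    change ((cechComplex U' G' ρ').d 0 (0 + 1)).hom z = _
    rw [OrderedCech.sysComplex_d]
    rfl
  have hsq : ∀ y : Γ(B', ⊤) ⊗[Γ(B, ⊤)] OrderedCech.SysCochain M 0,
      Φ₁ ((OrderedCech.sysD M 0).baseChange Γ(B', ⊤) y) = OrderedCech.sysD M' 0 (Φ₀ y) := by
    intro y
    induction y using TensorProduct.induction_on with
    | zero => rw [map_zero, map_zero, map_zero, map_zero]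
    | tmul b c =>
      have hc' : (C'.d 0 1).hom ((Φ.hom.f 0).hom (b ⊗ₜ c)) = (Φ.hom.f 1).hom (b ⊗ₜ (C.d 0 1).hom c) :=
        congrArg (fun φ => φ.hom (b ⊗ₜ[Γ(B, ⊤)] c)) (Φ.hom.comm 0 1)
      rw [LinearMap.baseChange_tmul, hΦ₀, hΦ₁, ← hd, ← hd']
      exact hc'.symm
    | add x y hx hy => rw [map_add, map_add, map_add, map_add, hx, hy]
  have hsq' : ∀ x : OrderedCech.SysCochain M' 0,
      Φ₁.symm.toLinearMap (OrderedCech.sysD M' 0 x) = (OrderedCech.sysD M 0).baseChange Γ(B', ⊤) (Φ₀.symm x) :=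
    fun x => by
    apply Φ₁.injective
    rw [LinearEquiv.coe_toLinearMap, LinearEquiv.apply_symm_apply, hsq, LinearEquiv.apply_symm_apply]
  let e₂ : LinearMap.ker (OrderedCech.sysD M' 0) ≃ₗ[Γ(B', ⊤)]
      LinearMap.ker ((OrderedCech.sysD M 0).baseChange Γ(B', ⊤)) :=
    kerEquivOfSquare (OrderedCech.sysD M' 0) ((OrderedCech.sysD M 0).baseChange Γ(B', ⊤)) Φ₀.symm
      Φ₁.symm.toLinearMap Φ₁.symm.injective hsq'
  let e₁ : SecMod G' ρ' ⊤ ≃ₗ[Γ(B', ⊤)] LinearMap.ker (OrderedCech.sysD M' 0) := kerDZeroEquiv U' G' ρ' hcov'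
  refine ⟨e₁.trans e₂, fun t => ?_⟩
  -- the square on elements: `η(t)|_{U'_s} = η(t|_{U_s})|`
  change Φ₀.symm (cechAugment U' G' ρ' (SecMod.mk (ρ := ρ') (unitSectionLE k G (V := ⊤) (U := ⊤) le_top
    (SecMod.val (L := G) (ρ := ρ) t)))) = (1 : Γ(B', ⊤)) ⊗ₜ[Γ(B, ⊤)] cechAugment U G ρ t
  rw [LinearEquiv.symm_apply_eq, hΦ₀]
  funext σ
  rw [hΦ 0 1 (cechAugment U G ρ t) σ, one_smul]
  apply SecMod.val_injective (L := G') (ρ := ρ')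
  rw [cechAugment_apply, SecMod.val_res]
  change _ = unitSectionLE k G _ (SecMod.val (L := G) (ρ := ρ) (cechAugment U G ρ t σ))
  rw [cechAugment_apply, SecMod.val_res]
  exact (unitSectionLE_map_of_le (UX := ⊤) (UY := ⊤) (UX' := cechOpen U σ.1) (UY' := cechOpen U' σ.1) G
    le_top (preimage_cechOpen U k σ.1).symm.le le_top le_top (SecMod.val (L := G) (ρ := ρ) t)).symm

end BaseChange

end Literature.AlgebraicGeometry.Modules

end
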